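import Summits.QuantumFields.YangMills.Theorems.BalabanUVNodesN18AvgPotentialCombGaugeLocal

/-!
# BalabanUVNodes ∕ node N18 = NE5 — closure-ledger item (iii), (β) AT THE CHART LEVEL, THE ONE-STEP STATEMENT: [Balaban1987RG1] (1.12)'s LOCAL GAUGE TRANSPORTED THROUGH
# ONE (0.4) AVERAGING — if `U^u = exp(iξA)` on the two blocks of a coarse bond `c` (the cube's gauge `u`, potential `A` Hermitian traceless, `|A| ≤ r`), then in the COARSE
# GAUGE `u′(y) := g(y)⁻¹·u(emb y)`, `g = exp(iξλ̄_A) ∈ SU(N)` (comb gauge of [Balaban1985Averaging] (62)–(63)), the averaged field reads `Ū^{u′}(c) = exp(iξ′Ā(c))`, `ξ′ = Lξ`,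
# with the gauge-clean letters of file 4: `ξ′|Ā(c)| ≤ Lξ·|A|_feed + 2000ℓ²ξ²r²`, `ξ′|Ā(c + e_ν) − Ā(c)| ≤ Lξ·L·r₁ + 3200ℓ²ξ²r·ρ_L` — FROM THE BLOCKS OF `c` (and `c + e_ν`) ONLY
# (Track A, DAG node N18 = `T4OutputRate.NE5` :211; cluster K4 «SpineRates», item K3⁷ `SpineGivenEndpointR13SepCoPH`; WIDTH SEAT pub-ymgap-dag-n18-w3 g2, file 5)

HONEST FRAMING.  Count-neutral kernel bookkeeping (`--supports stmt-QuantumFields-20544 --as helper`); elementary, PROVED: gauge covariance of the (0.4) average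
(`BlockAveraging.avgFun_covariant`: `avg(U^u) = (avg U)^{u∘emb}`), the `SU(N)`-valued comb gauge of file 3a (`exp_smul_combMean_mem_specialUnitaryGroup`, so the coarse gauge
EXISTS as an `SU(N)`-valued `GaugeTransf`), `NormedSpace.star_exp` (the inverse gauge factor is `exp(−iξλ̄_A)` for Hermitian `A`), and file 4's LOCAL double-bar letters at
the gauge-transformed fine field `U^u`.  NE5 is NOT PRINTED and NOT proved; N18 is NOT discharged; the transport clause `hT₀`∕`hTsp` is NOT discharged here.

WHY.  This is the shape (1.12) is consumed in: «for each cube `□ ⊂ X` of size `O(1)LM` there exists a `G`-valued gauge transformation `u` on `□` such that `U^u = exp iξA`,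
`|A|, |∇^ξA| < O(1)LMBα₀` on `□`» ([Balaban1987RG1] p.262), to be re-established one level up for the averaged field with the same form and constants `× (1 + O(d²L·ξα₀))`
(dag-n18-d `N18-BETA-SPEC.md` (β2)–(β5), (γ′)).  Files 1–4 produced the letters; this file names the COARSE GAUGE and states the transported clause bond by bond and pair by
pair, so that the `Sect2.CondI.localGauge` packaging on `cubesI` (dag-n18-d 19b∕19c vocabulary: `gaugeU`, `expI`, `grad`, cube bonds ∕ dpairs = two-block read sets and
feeding sites of the coarse cube's bonds) is a re-lettering, not an estimate.

WHAT (`N : ℕ`, `n = Fin N`; `U : GaugeField P j (SU(N))`, `u : GaugeTransf P j (SU(N))`, `A : PBond P j → M_N(ℂ)` bondwise Hermitian traceless; `0 ≤ ξ`, `48ℓξr ≤ 1`,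
`4ℓξr < δ_N`; standing range `j + 1 ≤ m + K`).
* §1 `exists_combGaugeSU` (an `SU(N)`-valued `g` with `(g y : M_N(ℂ)) = exp(iξλ̄_A(y))`), `coe_inv_eq_exp_neg_of_coe_eq_exp` (`(g y)⁻¹ = exp(−iξλ̄_A(y))` in `M_N(ℂ)`),
  ★ `coe_gaugeAct_avgFun_eq_combConj` (`(Ū^{u′})(c) = exp(−iξλ̄_A(c₋))·(avg U^u)(c)·exp(iξλ̄_A(c₊))` in `M_N(ℂ)`, `u′ = g⁻¹·(u∘emb)`).
* §2 ★ `coe_gaugeAct_avgFun_eq_exp_mlog` (`(Ū^{u′})(c) = exp(log (Ū^{u′})(c))` — the coarse field IS `exp(iξ′Ā)` in the gauge `u′`), ★ `norm_mlog_gaugeAct_avgFun_le_local` (SUP letter),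
  ★ `norm_shift_sub_mlog_gaugeAct_avgFun_le_local` (COARSE-DIFFERENCE letter) — file 4 at `U^u`, hypotheses on the blocks of `c` (and `c + e_ν`).

WHAT THIS IS NOT.  Not the `Sect2.CondI`∕`cubesI` packaging; not the radii step law (γ′); not (T1)∕(T2) nor the orbit-form (T3) knit (dag-n18-d 21 v1.1 ⇒ `hT₀`∕`hTsp`); not the
complexified (`(MatA N)ˣ`-valued) twins the orbit form ranges over; finite tori at fixed `ε` — not continuum ∕ OS ∕ mass gap ∕ Clay.  0 `def`, 0 `sorry`, standard axioms.
-/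

open scoped BigOperators

namespace YMDAG.N18.AvgPotential

open NormedSpace (exp)
open Literature.MathematicalPhysics.QuantumFieldTheory.Balaban1983to89
open Literature.MathematicalPhysics.QuantumFieldTheory.Balaban1983to89.T4Continuum
open Literature.MathematicalPhysics.QuantumFieldTheory.Balaban1983to89.BlockAveraging
open Literature.MathematicalPhysics.QuantumFieldTheory.Balaban1983to89.LatticeFieldCalculus (bondAvg runBond runSite)
open Literature.MathematicalPhysics.QuantumFieldTheory.Balaban1983to89.ExpMeanLog (deltaSU expMeanLogSU)
open Literature.MathematicalPhysics.QuantumFieldTheory.Balaban1983to89.MatrixLog (mlog)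
open Literature.MathematicalPhysics.QuantumFieldTheory.Balaban1983to89.BlockAveragingEMLLinearised (combMean)

open scoped Matrix.Norms.L2Operator

variable {N : ℕ} [NeZero N] {P : Params} {j : ℕ}

/-! ## §1 The coarse gauge `u′ = g⁻¹·(u∘emb)` and the gauge-transformed averaged field as the double bar -/

section CoarseGauge

omit [NeZero N] in
/-- **THE COMB GAUGE EXISTS AS AN `SU(N)`-VALUED GAUGE TRANSFORMATION** of the coarse lattice: for bondwise Hermitian traceless `A` there is `g : GaugeTransf P (j+1) (SU(N))`
with `(g y : M_N(ℂ)) = exp(iξ·λ̄_A(y))` at every coarse site (file 3a `exp_smul_combMean_mem_specialUnitaryGroup`). [cite: Balaban1985Averaging, (62)-(63) p.28] -/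
theorem exists_combGaugeSU {A : PBond P j → Matrix (Fin N) (Fin N) ℂ} (hAh : ∀ b, star (A b) = A b) (hAt : ∀ b, Matrix.trace (A b) = 0) (ξ : ℝ) :
    ∃ g : GaugeTransf P (j + 1) (Matrix.specialUnitaryGroup (Fin N) ℂ),
      ∀ y, ((g y : Matrix.specialUnitaryGroup (Fin N) ℂ) : Matrix (Fin N) (Fin N) ℂ) = exp ((Complex.I * ξ : ℂ) • combMean A y) :=
  ⟨fun y => ⟨exp ((Complex.I * ξ : ℂ) • combMean A y), (exp_smul_combMean_mem_specialUnitaryGroup hAh hAt ξ y).1⟩, fun _ => rfl⟩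

omit [NeZero N] in
/-- For Hermitian traceless `A`, the inverse of the comb gauge factor in `M_N(ℂ)` is `exp(−iξ·λ̄_A(y))` (`(g y)⁻¹ = (g y)⋆` in `SU(N)`, `NormedSpace.star_exp`, `λ̄_A(y)⋆ = λ̄_A(y)`).
[cite: Balaban1985Averaging, (62)-(63) p.28] -/
theorem coe_inv_eq_exp_neg_of_coe_eq_exp {A : PBond P j → Matrix (Fin N) (Fin N) ℂ} (hAh : ∀ b, star (A b) = A b) {ξ : ℝ}
    {g : GaugeTransf P (j + 1) (Matrix.specialUnitaryGroup (Fin N) ℂ)}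
    (hg : ∀ y, ((g y : Matrix.specialUnitaryGroup (Fin N) ℂ) : Matrix (Fin N) (Fin N) ℂ) = exp ((Complex.I * ξ : ℂ) • combMean A y)) (y : Site P (j + 1)) :
    (((g y)⁻¹ : Matrix.specialUnitaryGroup (Fin N) ℂ) : Matrix (Fin N) (Fin N) ℂ) = exp ((Complex.I * ξ : ℂ) • (-combMean A y)) := by
  have hstar : star ((Complex.I * ξ : ℂ) • combMean A y) = (Complex.I * ξ : ℂ) • (-combMean A y) := by
    rw [star_smul, star_combMean_of_selfAdjoint hAh, smul_neg, ← neg_smul]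
    congr 1
    rw [Complex.star_def, map_mul, Complex.conj_I, Complex.conj_ofReal, neg_mul]
  show star ((g y : Matrix.specialUnitaryGroup (Fin N) ℂ) : Matrix (Fin N) (Fin N) ℂ) = _
  rw [hg, NormedSpace.star_exp, hstar]

/-- ★ **THE AVERAGED FIELD IN THE COARSE GAUGE IS THE DOUBLE BAR OF THE GAUGE-TRANSFORMED FINE FIELD**: with `u′ y := (g y)⁻¹·u(emb y)`,
`(Ū^{u′})(c) = exp(−iξλ̄_A(c₋)) · (avg (U^u))(c) · exp(iξλ̄_A(c₊))` in `M_N(ℂ)` — gauge covariance of (0.4) (`BlockAveraging.avgFun_covariant`) and §1's inverse factor.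
[cite: Balaban1985Averaging, (11) p.18, (62)-(63) p.28 and (93) p.32; Balaban1987RG1, (0.4) p.253] -/
theorem coe_gaugeAct_avgFun_eq_combConj (hj : j + 1 ≤ P.m + P.K) (U : GaugeField P j (Matrix.specialUnitaryGroup (Fin N) ℂ))
    (u : GaugeTransf P j (Matrix.specialUnitaryGroup (Fin N) ℂ)) {A : PBond P j → Matrix (Fin N) (Fin N) ℂ} (hAh : ∀ b, star (A b) = A b) {ξ : ℝ}
    {g : GaugeTransf P (j + 1) (Matrix.specialUnitaryGroup (Fin N) ℂ)}
    (hg : ∀ y, ((g y : Matrix.specialUnitaryGroup (Fin N) ℂ) : Matrix (Fin N) (Fin N) ℂ) = exp ((Complex.I * ξ : ℂ) • combMean A y)) (c : PBond P (j + 1)) :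
    ((GaugeField.gaugeAct (fun y => (g y)⁻¹ * u (emb y)) (avgFun (expMeanLogSU (n := Fin N)) U) c : Matrix.specialUnitaryGroup (Fin N) ℂ) : Matrix (Fin N) (Fin N) ℂ) =
      exp ((Complex.I * ξ : ℂ) • (-combMean A c.src)) *
        (((avgFun (expMeanLogSU (n := Fin N)) (GaugeField.gaugeAct u U) c : Matrix.specialUnitaryGroup (Fin N) ℂ) : Matrix (Fin N) (Fin N) ℂ)) *
        exp ((Complex.I * ξ : ℂ) • combMean A c.tgt) := by
  rw [avgFun_covariant _ hj u U]
  simp only [GaugeField.gaugeAct, mul_inv_rev, inv_inv]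
  rw [← coe_inv_eq_exp_neg_of_coe_eq_exp hAh hg c.src, ← hg c.tgt]
  simp only [Submonoid.coe_mul, mul_assoc]

end CoarseGauge

/-! ## §2 The transported (1.12) clause at one coarse bond and one coarse pair, from the blocks only -/

section Transport

/-- ★ **`Ū^{u′}(c) = exp(log Ū^{u′}(c))` — THE AVERAGED FIELD IS `exp(iξ′Ā)` IN THE COARSE GAUGE** (`ξ′Ā(c) := (1∕i)·log Ū^{u′}(c)`): if `U^u = exp(iξA)` and `‖A‖ ≤ r` on the
bonds with both ends in `B(c₋) ∪ B(c₊)` (`48ℓξr ≤ 1`, `4ℓξr < δ_N`), the gauge-transformed averaged field at `c` lies in the ball of the logarithm and equals the exponential of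
its logarithm (file 4 at `U^u` + file 3b `exp_mlog` on the ball `20ℓξr`). [cite: Balaban1987RG1, (1.12) p.262; Balaban1985Averaging, (93) p.32] -/
theorem coe_gaugeAct_avgFun_eq_exp_mlog (hj : j + 1 ≤ P.m + P.K) (U : GaugeField P j (Matrix.specialUnitaryGroup (Fin N) ℂ))
    (u : GaugeTransf P j (Matrix.specialUnitaryGroup (Fin N) ℂ)) {A : PBond P j → Matrix (Fin N) (Fin N) ℂ} (hAh : ∀ b, star (A b) = A b) {ξ r : ℝ}
    (hξ : 0 ≤ ξ) (hr : 0 ≤ r) {g : GaugeTransf P (j + 1) (Matrix.specialUnitaryGroup (Fin N) ℂ)}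
    (hg : ∀ y, ((g y : Matrix.specialUnitaryGroup (Fin N) ℂ) : Matrix (Fin N) (Fin N) ℂ) = exp ((Complex.I * ξ : ℂ) • combMean A y)) (c : PBond P (j + 1))
    (hUA : ∀ b : PBond P j, (blockOf b.src = c.src ∨ blockOf b.src = c.tgt) → (blockOf b.tgt = c.src ∨ blockOf b.tgt = c.tgt) →
      ((GaugeField.gaugeAct u U b : Matrix.specialUnitaryGroup (Fin N) ℂ) : Matrix (Fin N) (Fin N) ℂ) = exp ((Complex.I * ξ : ℂ) • A b))
    (hA : ∀ b : PBond P j, (blockOf b.src = c.src ∨ blockOf b.src = c.tgt) → (blockOf b.tgt = c.src ∨ blockOf b.tgt = c.tgt) → ‖A b‖ ≤ r)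
    (h48 : 48 * ((((P.d + 2) * P.L : ℕ) : ℝ) * (ξ * r)) ≤ 1) (hN : 4 * ((((P.d + 2) * P.L : ℕ) : ℝ) * (ξ * r)) < deltaSU (Fin N)) :
    exp (mlog (((GaugeField.gaugeAct (fun y => (g y)⁻¹ * u (emb y)) (avgFun (expMeanLogSU (n := Fin N)) U) c : Matrix.specialUnitaryGroup (Fin N) ℂ) :
        Matrix (Fin N) (Fin N) ℂ))) =
      ((GaugeField.gaugeAct (fun y => (g y)⁻¹ * u (emb y)) (avgFun (expMeanLogSU (n := Fin N)) U) c : Matrix.specialUnitaryGroup (Fin N) ℂ) : Matrix (Fin N) (Fin N) ℂ) := by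
  classical
  rw [coe_gaugeAct_avgFun_eq_combConj hj U u hAh hg c]
  -- the cutoff pair of `U^u` on the two blocks (as in file 4)
  set R : PBond P j → Prop := fun b => (blockOf b.src = c.src ∨ blockOf b.src = c.tgt) ∧ (blockOf b.tgt = c.src ∨ blockOf b.tgt = c.tgt) with hR
  set U0 : GaugeField P j (Matrix.specialUnitaryGroup (Fin N) ℂ) := fun b => if R b then GaugeField.gaugeAct u U b else 1 with hU0
  set A0 : PBond P j → Matrix (Fin N) (Fin N) ℂ := fun b => if R b then A b else 0 with hA0
  have hUA0 : ∀ b, ((U0 b : Matrix.specialUnitaryGroup (Fin N) ℂ) : Matrix (Fin N) (Fin N) ℂ) = exp ((Complex.I * ξ : ℂ) • A0 b) := by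
    intro b
    by_cases hb : R b
    · simp only [hU0, hA0, if_pos hb]; exact hUA b hb.1 hb.2
    · simp only [hU0, hA0, if_neg hb, smul_zero, NormedSpace.exp_zero]; rfl
  have hA0r : ∀ b, ‖A0 b‖ ≤ r := by
    intro b
    by_cases hb : R b
    · simp only [hA0, if_pos hb]; exact hA b hb.1 hb.2
    · simp only [hA0, if_neg hb, norm_zero]; exact hr
  have havg : avgFun (expMeanLogSU (n := Fin N)) (GaugeField.gaugeAct u U) c = avgFun (expMeanLogSU (n := Fin N)) U0 c :=
    T4ReflectionConeSharp.avgFun_congr₂ _ hj _ U0 c fun b h1 h2 => by simp only [hU0, if_pos (show R b from ⟨h1, h2⟩)]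
  have hsrc : combMean A c.src = combMean A0 c.src :=
    combMean_congr_block hj c.src fun b h1 h2 => by simp only [hA0, if_pos (show R b from ⟨Or.inl h1, Or.inl h2⟩)]
  have htgt : combMean A c.tgt = combMean A0 c.tgt :=
    combMean_congr_block hj c.tgt fun b h1 h2 => by simp only [hA0, if_pos (show R b from ⟨Or.inr h1, Or.inr h2⟩)]
  rw [havg, hsrc, htgt]
  exact exp_mlog_combConj U0 A0 hξ hr hUA0 hA0r h48 hN c

/-- ★ **THE SUP LETTER OF THE TRANSPORTED CLAUSE** (`ξ′|Ā(c)|`): under the hypotheses of `coe_gaugeAct_avgFun_eq_exp_mlog` and `‖A‖ ≤ a` on the `L^{d+1}` FEEDING bonds of `c`: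
`‖log Ū^{u′}(c)‖ ≤ (Lξ)·a + 2000·ℓ²ξ²r²` — i.e. `|Ā(c)| ≤ |A|_feed + 2000(d+2)²·L·ξ·r²`: print's `|Ā| < O(1)LMBα₀` from `|A| < O(1)LMBα₀` with the relative slack `O(ℓ²ξα₀)`, FROM THE TWO
BLOCKS. [cite: Balaban1987RG1, (1.12) p.262; Balaban1985Averaging, (93) p.32 and Prop. 3 (123) p.36] -/
theorem norm_mlog_gaugeAct_avgFun_le_local (hj : j + 1 ≤ P.m + P.K) (U : GaugeField P j (Matrix.specialUnitaryGroup (Fin N) ℂ))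
    (u : GaugeTransf P j (Matrix.specialUnitaryGroup (Fin N) ℂ)) {A : PBond P j → Matrix (Fin N) (Fin N) ℂ} (hAh : ∀ b, star (A b) = A b) {ξ r a : ℝ}
    (hξ : 0 ≤ ξ) (hr : 0 ≤ r) {g : GaugeTransf P (j + 1) (Matrix.specialUnitaryGroup (Fin N) ℂ)}
    (hg : ∀ y, ((g y : Matrix.specialUnitaryGroup (Fin N) ℂ) : Matrix (Fin N) (Fin N) ℂ) = exp ((Complex.I * ξ : ℂ) • combMean A y)) (c : PBond P (j + 1))
    (hUA : ∀ b : PBond P j, (blockOf b.src = c.src ∨ blockOf b.src = c.tgt) → (blockOf b.tgt = c.src ∨ blockOf b.tgt = c.tgt) →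
      ((GaugeField.gaugeAct u U b : Matrix.specialUnitaryGroup (Fin N) ℂ) : Matrix (Fin N) (Fin N) ℂ) = exp ((Complex.I * ξ : ℂ) • A b))
    (hA : ∀ b : PBond P j, (blockOf b.src = c.src ∨ blockOf b.src = c.tgt) → (blockOf b.tgt = c.src ∨ blockOf b.tgt = c.tgt) → ‖A b‖ ≤ r)
    (ha : ∀ ρ : Fin P.d → Fin P.L, ∀ t < P.L, ‖A (runBond (Site.blockSite c.src ρ) c.dir t)‖ ≤ a)
    (h48 : 48 * ((((P.d + 2) * P.L : ℕ) : ℝ) * (ξ * r)) ≤ 1) (hN : 4 * ((((P.d + 2) * P.L : ℕ) : ℝ) * (ξ * r)) < deltaSU (Fin N)) :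
    ‖mlog (((GaugeField.gaugeAct (fun y => (g y)⁻¹ * u (emb y)) (avgFun (expMeanLogSU (n := Fin N)) U) c : Matrix.specialUnitaryGroup (Fin N) ℂ) :
        Matrix (Fin N) (Fin N) ℂ))‖ ≤ P.L * ξ * a + 2000 * (((P.d + 2) * P.L : ℕ) : ℝ) ^ 2 * ξ ^ 2 * r ^ 2 := by
  rw [coe_gaugeAct_avgFun_eq_combConj hj U u hAh hg c]
  exact norm_mlog_combConj_le_local hj (GaugeField.gaugeAct u U) A c hξ hr hUA hA ha h48 hN

/-- ★ **THE COARSE-DIFFERENCE LETTER OF THE TRANSPORTED CLAUSE** (`ξ′|Ā(c′) − Ā(c)|`, `c = ⟨y, μ⟩`, `c′ = ⟨y + e_ν, μ⟩`): `U^u = exp(iξA)`, `‖A‖ ≤ r` on the bonds with both ends in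
the blocks of `c` or of `c′`; `‖A(b + Le_ν) − A(b)‖ ≤ ρ_L` on the blocks of `c`; unit `ν`-differences of `A(·, μ)` `≤ r₁` at the `L^{d+2}` feeding sites of `c`:
`‖log Ū^{u′}(c′) − log Ū^{u′}(c)‖ ≤ (Lξ)·(L·r₁) + 3200·ℓ²ξ²r·ρ_L` — with `r₁, ρ_L∕L ≤ ξ·sup_□|∇^ξ_νA|`: `|∇^{ξ′}_ν Ā| ≤ sup_□|∇^ξ_νA|·(1 + 3200(d+2)²·L·ξr)`: print's
`|∇^ξĀ| < O(1)LMBα₀` transport, King's exact K-row times a summable relative slack, FROM THE BLOCKS ONLY. [cite: Balaban1987RG1, (1.12) p.262; Balaban1985Averaging, (62)-(63) p.28, (93) p.32, Prop. 3 (123) p.36] -/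
theorem norm_shift_sub_mlog_gaugeAct_avgFun_le_local (hj : j + 1 ≤ P.m + P.K) (U : GaugeField P j (Matrix.specialUnitaryGroup (Fin N) ℂ))
    (u : GaugeTransf P j (Matrix.specialUnitaryGroup (Fin N) ℂ)) {A : PBond P j → Matrix (Fin N) (Fin N) ℂ} (hAh : ∀ b, star (A b) = A b) (y : Site P (j + 1))
    (μ ν : Fin P.d) {ξ r ρL r₁ : ℝ} (hξ : 0 ≤ ξ) (hr : 0 ≤ r) (hρL : 0 ≤ ρL) {g : GaugeTransf P (j + 1) (Matrix.specialUnitaryGroup (Fin N) ℂ)}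
    (hg : ∀ y, ((g y : Matrix.specialUnitaryGroup (Fin N) ℂ) : Matrix (Fin N) (Fin N) ℂ) = exp ((Complex.I * ξ : ℂ) • combMean A y))
    (hUA : ∀ b : PBond P j,
      ((blockOf b.src = y ∨ blockOf b.src = y.shift μ) ∧ (blockOf b.tgt = y ∨ blockOf b.tgt = y.shift μ)) ∨
        ((blockOf b.src = y.shift ν ∨ blockOf b.src = (y.shift ν).shift μ) ∧ (blockOf b.tgt = y.shift ν ∨ blockOf b.tgt = (y.shift ν).shift μ)) →
      ((GaugeField.gaugeAct u U b : Matrix.specialUnitaryGroup (Fin N) ℂ) : Matrix (Fin N) (Fin N) ℂ) = exp ((Complex.I * ξ : ℂ) • A b))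
    (hA : ∀ b : PBond P j,
      ((blockOf b.src = y ∨ blockOf b.src = y.shift μ) ∧ (blockOf b.tgt = y ∨ blockOf b.tgt = y.shift μ)) ∨
        ((blockOf b.src = y.shift ν ∨ blockOf b.src = (y.shift ν).shift μ) ∧ (blockOf b.tgt = y.shift ν ∨ blockOf b.tgt = (y.shift ν).shift μ)) → ‖A b‖ ≤ r)
    (hAL : ∀ b : PBond P j, (blockOf b.src = y ∨ blockOf b.src = y.shift μ) → (blockOf b.tgt = y ∨ blockOf b.tgt = y.shift μ) →
      ‖A (b.translate (P.L • (0 : Site P j).shift ν)) - A b‖ ≤ ρL)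
    (hA₁ : ∀ ρ : Fin P.d → Fin P.L, ∀ t < P.L, ∀ s < P.L,
      ‖A ⟨(runSite (runSite (Site.blockSite y ρ) μ t) ν s).shift ν, μ⟩ - A ⟨runSite (runSite (Site.blockSite y ρ) μ t) ν s, μ⟩‖ ≤ r₁)
    (h48 : 48 * ((((P.d + 2) * P.L : ℕ) : ℝ) * (ξ * r)) ≤ 1) (hN : 4 * ((((P.d + 2) * P.L : ℕ) : ℝ) * (ξ * r)) < deltaSU (Fin N)) :
    ‖mlog (((GaugeField.gaugeAct (fun y => (g y)⁻¹ * u (emb y)) (avgFun (expMeanLogSU (n := Fin N)) U) ⟨y.shift ν, μ⟩ : Matrix.specialUnitaryGroup (Fin N) ℂ) :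
          Matrix (Fin N) (Fin N) ℂ)) -
        mlog (((GaugeField.gaugeAct (fun y => (g y)⁻¹ * u (emb y)) (avgFun (expMeanLogSU (n := Fin N)) U) ⟨y, μ⟩ : Matrix.specialUnitaryGroup (Fin N) ℂ) :
          Matrix (Fin N) (Fin N) ℂ))‖ ≤
      P.L * ξ * (P.L * r₁) + 3200 * (((P.d + 2) * P.L : ℕ) : ℝ) ^ 2 * ξ ^ 2 * r * ρL := by
  rw [coe_gaugeAct_avgFun_eq_combConj hj U u hAh hg ⟨y.shift ν, μ⟩, coe_gaugeAct_avgFun_eq_combConj hj U u hAh hg ⟨y, μ⟩]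
  exact norm_shift_sub_mlog_combConj_le_local hj (GaugeField.gaugeAct u U) A y μ ν hξ hr hρL hUA hA hAL hA₁ h48 hN

end Transport

end YMDAG.N18.AvgPotential
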